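import Summits.CriticalPhenomena.CardyFormulaZ2.Theorems.CardyIKTransportIKLinearTransportStubCutMarkovKernelDerived

/-!
# Stub `stub_CutMarkovKernel` (K) — part G: THE CUT-MARKOV KERNEL (definition, measurability, normalisation,
# cut-Markov reading)

Support file (`--supports stmt-CriticalPhenomena-5076`, registered sub-goal `cmk_kernel_reads`).

THE VERSION. `cmkCstar i p` is the LAST CUT ROW `≤ -1` of the environment `p` (`0` if there is none). The kernel
`cmkK i T` at a statistic value `t = (p, z)`:
* if `cmkCstar i p = 0`, the regular conditional distribution of the middle row `0` given the full row
  statistic (Mathlib's `condDistrib`, any version);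
* if `cmkCstar i p = c ≤ -1`, the regular conditional distribution `cmkKer i T c` of the middle row `0` given
  (SHARED COORDINATES, UPPER STATISTIC, MIDDLE ROWS `(c, 0)`) under (shared sample ⊗ upper noise), evaluated at
  the value READ OFF `t`: shared coordinates from the environment (`cmkΓ`), upper statistic from the strip
  diagram (`cmkPi2'`), and the rows `(c, 0)` of the past `z` (`cmkTrunc`) — so that it reads the past only
  strictly above the last cut (`cmk_kernel_reads`, registered), surely, by construction.
This file also collects the measurability of all the maps of parts E–F.
-/

noncomputable section

namespace Summit.CriticalPhenomena.CardyFormulaZ2.Theorems.IKLinearTransport.PinnedDiagramExchange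

open scoped Classical MeasureTheory ENNReal ProbabilityTheory symmDiff
open Set MeasureTheory ProbabilityTheory
open Literature.Probability.Percolation Literature.Probability.LatticeModels

/-! ## Measurability -/

section Meas

variable (i : ℤ) (T : Set ℤ) (c : ℤ)

/-- `cmkConf` is measurable. [folklore] -/
theorem cmk_measurable_conf : Measurable (cmkConf i T c) := (cmk_measurable_Ξ i T c).comp (cmk_measurable_glue3 i _ c)

/-- `cmkUconf` is measurable. [folklore] -/
theorem cmk_measurable_uconf : Measurable (cmkUconf i T c) :=
  (cmk_measurable_conf i T c).comp (measurable_const.prodMk measurable_id)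

/-- `cmkLconf` is measurable. [folklore] -/
theorem cmk_measurable_lconf : Measurable (cmkLconf i T c) :=
  (cmk_measurable_conf i T c).comp (measurable_fst.prodMk (measurable_snd.prodMk measurable_const))

/-- `cmkTrunc` is measurable. [folklore] -/
theorem cmk_measurable_trunc : Measurable (cmkTrunc c) :=
  (measurable_set_iff.2 fun w => ((measurable_set_mem w).comp measurable_fst).and measurable_const).prodMk
    (measurable_set_iff.2 fun f => ((measurable_set_mem f).comp measurable_snd).and measurable_const)

/-- `cmkUn` is measurable. [folklore] -/
theorem cmk_measurable_un : Measurable fun q : Obs × Obs => cmkUn q.1 q.2 :=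
  (measurable_set_iff.2 fun w => ((measurable_set_mem w).comp (measurable_fst.comp measurable_fst)).or
    ((measurable_set_mem w).comp (measurable_fst.comp measurable_snd))).prodMk
    (measurable_set_iff.2 fun f => ((measurable_set_mem f).comp (measurable_snd.comp measurable_fst)).or
      ((measurable_set_mem f).comp (measurable_snd.comp measurable_snd)))

/-- `cmkFlat` is measurable. [folklore] -/
theorem cmk_measurable_flat : Measurable (cmkFlat i c) :=
  measurable_fst.prodMk (measurable_set_iff.2 fun f => ((measurable_set_mem f).comp measurable_snd).or measurable_const)

/-- Half-strip reachabilities are measurable set-valued maps. [folklore] -/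
theorem cmk_measurable_UpR_LoR : Measurable (cmkUpR i c) ∧ Measurable (cmkLoR i c) :=
  ⟨measurable_set_iff.2 fun pq => measurableSet_setOf.1 (measurableSet_cmkUpR_obs i c pq),
   measurable_set_iff.2 fun pq => measurableSet_setOf.1 (measurableSet_cmkLoR_obs i c pq)⟩

/-- Evaluation of a set-valued measurable map at a point is measurable. [folklore] -/
theorem cmk_measurable_mem {α β : Type*} [MeasurableSpace α] {F : α → Set β} (hF : Measurable F) (b : β) :
    Measurable fun a => b ∈ F a := measurable_set_iff.1 hF b

/-- The upper statistic is measurable. [folklore] -/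
theorem cmk_measurable_ustat : Measurable (cmkUstat i c) := by
  have hU : Measurable fun x => cmkUpR i c (cmkFlat i c x) := (cmk_measurable_UpR_LoR i c).1.comp (cmk_measurable_flat i c)
  refine (measurable_set_iff.2 fun pq => measurable_const.and (measurable_const.and (cmk_measurable_mem hU pq))).prodMk
    ((cmk_measurable_mem hU _).prodMk (cmk_measurable_mem hU _).not)

/-- The upper maps are measurable. [folklore] -/
theorem cmk_measurable_upper : Measurable (cmkY i T c) ∧ Measurable (cmkV i T c) ∧ Measurable (cmkUst i T c) :=
  ⟨(measurable_rowBool i).comp (cmk_measurable_uconf i T c),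
   (cmk_measurable_trunc c).comp ((measurable_pastMid i 0).comp (cmk_measurable_uconf i T c)),
   (cmk_measurable_ustat i c).comp (cmk_measurable_uconf i T c)⟩

/-- The boundary pattern is a measurable predicate. [folklore] -/
theorem cmk_measurable_pattern : Measurable (cmkPattern i c) := by
  have hcell : ∀ v : Site 2, Measurable fun x : Obs => v ∈ x.1 := fun v => (measurable_set_mem v).comp measurable_fst
  unfold cmkPattern
  exact (Measurable.forall fun y => Measurable.imp measurable_const (Measurable.imp measurable_const
    (((hcell _).iff (hcell _)).and ((hcell _).iff (hcell _))))).and (((hcell _).iff (hcell _).not).and ((hcell _).iff (hcell _).not))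

/-- The cut predicate from (lower configuration, upper statistic) is measurable. [folklore] -/
theorem cmk_measurable_C : Measurable fun q : Obs × (Set (Site 2 × Site 2) × Prop × Prop) => cmkC i c q.1 q.2 := by
  have hL := (cmk_measurable_UpR_LoR i c).2
  unfold cmkC
  exact ((cmk_measurable_pattern i c).comp measurable_fst).and (((cmk_measurable_mem hL _).comp measurable_fst).not.and
    (((cmk_measurable_mem hL _).comp measurable_fst).and ((measurable_snd.comp (measurable_snd.comp measurable_snd)).and
      (measurable_fst.comp (measurable_snd.comp measurable_snd)))))

/-- Assembling a diagram is measurable. [folklore] -/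
theorem cmk_measurable_comb : Measurable fun q : Set (Site 2 × Site 2) × Set (Site 2 × Site 2) => cmkComb i c q.1 q.2 := by
  have hm : ∀ pq : Site 2 × Site 2, Measurable fun q : Set (Site 2 × Site 2) × Set (Site 2 × Site 2) => pq ∈ q.1 := fun pq =>
    (measurable_set_mem pq).comp measurable_fst
  have hm' : ∀ pq : Site 2 × Site 2, Measurable fun q : Set (Site 2 × Site 2) × Set (Site 2 × Site 2) => pq ∈ q.2 := fun pq =>
    (measurable_set_mem pq).comp measurable_snd
  refine measurable_set_iff.2 fun pq => ?_
  simp only [cmkComb, mem_setOf_eq]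
  exact measurable_const.and (measurable_const.and ((measurable_const.and (measurable_const.and (hm _))).or
    ((measurable_const.and (measurable_const.and (hm' _))).or ((Measurable.exists fun X => measurable_const.and
      ((hm _).and (hm' _))).or (Measurable.exists fun X => measurable_const.and ((hm' _).and (hm _)))))))

/-- Reading the upper statistic off a diagram is measurable. [folklore] -/
theorem cmk_measurable_pi2' : Measurable (cmkPi2' i c) := by
  refine (measurable_set_iff.2 fun pq => ?_).prodMk measurable_const
  simp only [cmkPi2, mem_setOf_eq]
  exact (measurable_const.and (measurable_const.and (measurable_const.and (measurable_const.and (measurable_set_mem _))))).or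
    ((measurable_const.and (measurable_const.and (measurable_const.and (measurable_set_mem _)))).or
      ((measurable_const.and (measurable_const.and (measurable_const.and (measurable_set_mem _)))).or measurable_const))

/-- The reassembled row statistic is measurable. [folklore] -/
theorem cmk_measurable_RS : Measurable fun q : Obs × (Set (Site 2 × Site 2) × Prop × Prop) × Obs => cmkRS i c q.1 q.2.1 q.2.2 := by
  have hL := (cmk_measurable_UpR_LoR i c).2
  unfold cmkRS
  exact (((measurable_eraseMid i).comp measurable_fst).prodMk ((cmk_measurable_comb i c).comp
    ((hL.comp measurable_fst).prodMk (measurable_fst.comp (measurable_fst.comp measurable_snd))))).prodMk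
    (cmk_measurable_un.comp (((measurable_pastMid i (c + 1)).comp measurable_fst).prodMk (measurable_snd.comp measurable_snd)))

/-- Xor of measurable bits is measurable. [folklore] -/
theorem cmk_measurable_bxor {α : Type*} [MeasurableSpace α] {f g : α → Bool} (hf : Measurable f) (hg : Measurable g) :
    Measurable fun a => f a ^^ g a := (measurable_of_countable fun p : Bool × Bool => p.1 ^^ p.2).comp (hf.prodMk hg)

/-- And of measurable bits is measurable. [folklore] -/
theorem cmk_measurable_band {α : Type*} [MeasurableSpace α] {f g : α → Bool} (hf : Measurable f) (hg : Measurable g) :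
    Measurable fun a => f a && g a := (measurable_of_countable fun p : Bool × Bool => p.1 && p.2).comp (hf.prodMk hg)

/-- Or of measurable bits is measurable. [folklore] -/
theorem cmk_measurable_bor {α : Type*} [MeasurableSpace α] {f g : α → Bool} (hf : Measurable f) (hg : Measurable g) :
    Measurable fun a => f a || g a := (measurable_of_countable fun p : Bool × Bool => p.1 || p.2).comp (hf.prodMk hg)

/-- Negation of a measurable bit is measurable. [folklore] -/
theorem cmk_measurable_bnot {α : Type*} [MeasurableSpace α] {f : α → Bool} (hf : Measurable f) : Measurable fun a => !f a :=
  (measurable_of_countable fun p : Bool => !p).comp hf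

/-- Reading the shared coordinates off the environment is measurable. [folklore] -/
theorem cmk_measurable_Γ (τ : Bool) : Measurable (cmkΓ i τ c) := by
  have hξ : ∀ y, Measurable fun E : Obs => cmkξE i E y := fun y => crk_measurable_decide ((measurable_set_mem _).comp measurable_fst)
  have hζ : ∀ y, Measurable fun E : Obs => cmkζE i E y := fun y => crk_measurable_decide ((measurable_set_mem _).comp measurable_fst)
  have hF : ∀ y, Measurable fun E : Obs => cmkFE i E y := fun y =>
    cmk_measurable_bxor (cmk_measurable_bxor (cmk_measurable_bxor (hζ _) (hξ _)) (hζ _)) (hξ _)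
  have hFf : Measurable fun E : Obs => cmkFE i E := measurable_pi_lambda _ hF
  have hbp : Measurable fun E : Obs => SDE.bp (cmkFE i E) 0 c := by
    refine (cmk_measurable_of_det (fun F : ℤ → Bool => SDE.bp F 0 c) (Finset.Ico (min 0 c) (max 0 c)) fun b b' hb => ?_).comp hFf
    exact cmk_bp_congr' hb
  refine measurable_pi_lambda _ fun j => ?_
  rcases j with x | y | f | f | f
  · exact cmk_measurable_bor (cmk_measurable_band measurable_const (cmk_measurable_bxor (hζ 0) (hξ 0)))
      (cmk_measurable_band measurable_const (cmk_measurable_bnot (cmk_measurable_band measurable_const hbp)))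
  · exact cmk_measurable_band measurable_const (hξ y)
  · exact measurable_const
  · exact cmk_measurable_band measurable_const (hF _)
  · exact measurable_const

end Meas

/-! ## The last cut row below row `0` -/

/-- THE LAST CUT ROW `≤ -1` of an environment (`0` when there is none). [folklore] -/
def cmkCstar (i : ℤ) (p : Obs × Set (Site 2 × Site 2)) : ℤ :=
  if h : ∃ c : ℤ, c ≤ -1 ∧ IsCut i c p then (Int.greatestOfBdd (P := fun c => c ≤ -1 ∧ IsCut i c p) (-1) (fun _ hz => hz.1) h : ℤ) else 0

/-- A cut row `≤ -1` lies below the last one, which is a cut row `≤ -1`. [folklore] -/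
theorem cmk_cstar_of_isCut (i : ℤ) {p : Obs × Set (Site 2 × Site 2)} {c : ℤ} (hc : c ≤ -1) (h : IsCut i c p) :
    cmkCstar i p ≤ -1 ∧ c ≤ cmkCstar i p ∧ IsCut i (cmkCstar i p) p := by
  have hex : ∃ c : ℤ, c ≤ -1 ∧ IsCut i c p := ⟨c, hc, h⟩
  rw [cmkCstar, dif_pos hex]
  obtain ⟨⟨h1, h2⟩, h3⟩ := (Int.greatestOfBdd (P := fun c => c ≤ -1 ∧ IsCut i c p) (-1) (fun _ hz => hz.1) hex).2
  exact ⟨h1, h3 c ⟨hc, h⟩, h2⟩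

/-- A negative value of `cmkCstar` is a cut row. [folklore] -/
theorem cmk_isCut_of_cstar (i : ℤ) {p : Obs × Set (Site 2 × Site 2)} {c : ℤ} (hc : c ≤ -1) (h : cmkCstar i p = c) : IsCut i c p := by
  by_cases hex : ∃ c : ℤ, c ≤ -1 ∧ IsCut i c p
  · rw [cmkCstar, dif_pos hex] at h
    have := (Int.greatestOfBdd (P := fun c => c ≤ -1 ∧ IsCut i c p) (-1) (fun _ hz => hz.1) hex).2.1.2
    rwa [h] at this
  · rw [cmkCstar, dif_neg hex] at h; omega

/-- Characterisation of the negative level sets of `cmkCstar`. [folklore] -/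
theorem cmk_cstar_eq_iff (i : ℤ) (p : Obs × Set (Site 2 × Site 2)) {c : ℤ} (hc : c ≤ -1) :
    cmkCstar i p = c ↔ IsCut i c p ∧ ∀ c', c < c' → c' ≤ -1 → ¬ IsCut i c' p := by
  constructor
  · intro h
    refine ⟨cmk_isCut_of_cstar i hc h, fun c' h1 h2 h3 => ?_⟩
    have := (cmk_cstar_of_isCut i h2 h3).2.1; omega
  · rintro ⟨h1, h2⟩
    obtain ⟨h3, h4, h5⟩ := cmk_cstar_of_isCut i hc h1
    by_contra hne
    exact h2 _ (by omega) h3 h5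

/-- Characterisation of the nonnegative level sets of `cmkCstar`. [folklore] -/
theorem cmk_cstar_eq_iff' (i : ℤ) (p : Obs × Set (Site 2 × Site 2)) {c : ℤ} (hc : ¬ c ≤ -1) :
    cmkCstar i p = c ↔ c = 0 ∧ ∀ c', c' ≤ -1 → ¬ IsCut i c' p := by
  constructor
  · intro h
    by_cases hex : ∃ c : ℤ, c ≤ -1 ∧ IsCut i c p
    · obtain ⟨c', h1, h2⟩ := hex
      have := (cmk_cstar_of_isCut i h1 h2).1; omega
    · rw [cmkCstar, dif_neg hex] at h
      exact ⟨h.symm, fun c' h1 h2 => hex ⟨c', h1, h2⟩⟩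
  · rintro ⟨rfl, h⟩
    rw [cmkCstar, dif_neg]; rintro ⟨c', h1, h2⟩; exact h c' h1 h2

/-- `cmkCstar` is measurable. [folklore] -/
theorem cmk_measurable_cstar (i : ℤ) : Measurable (cmkCstar i) := by
  refine measurable_to_countable' fun c => ?_
  by_cases hc : c ≤ -1
  · have : cmkCstar i ⁻¹' {c} = {p | IsCut i c p ∧ ∀ c', c < c' → c' ≤ -1 → ¬ IsCut i c' p} := by
      ext p; simp only [mem_preimage, mem_singleton_iff, mem_setOf_eq, cmk_cstar_eq_iff i p hc]
    rw [this]
    exact measurableSet_setOf.2 ((measurable_isCut i c).and (Measurable.forall fun c' => Measurable.imp measurable_const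
      (Measurable.imp measurable_const (measurable_isCut i c').not)))
  · have : cmkCstar i ⁻¹' {c} = {p | c = 0 ∧ ∀ c', c' ≤ -1 → ¬ IsCut i c' p} := by
      ext p; simp only [mem_preimage, mem_singleton_iff, mem_setOf_eq, cmk_cstar_eq_iff' i p hc]
    rw [this]
    exact measurableSet_setOf.2 (measurable_const.and (Measurable.forall fun c' => Measurable.imp measurable_const
      (measurable_isCut i c').not))

/-! ## The kernel -/

/-- The statistic space of the upper conditional distribution: (shared sample, upper statistic, rows `(c,0)`). [folklore] -/
abbrev cmkStatSp : Type := SDE.KJ × (Set (Site 2 × Site 2) × Prop × Prop) × Obs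

/-- The upper conditioning map `(θ, b) ↦ (θ, upper statistic, rows (c, 0))`. [folklore] -/
def cmkX (i : ℤ) (T : Set ℤ) (c : ℤ) (θb : SDE.KJ × SDE.KJ) : cmkStatSp := (θb.1, cmkUst i T c θb, cmkV i T c θb)

/-- `cmkX` is measurable. [folklore] -/
theorem cmk_measurable_X (i : ℤ) (T : Set ℤ) (c : ℤ) : Measurable (cmkX i T c) :=
  measurable_fst.prodMk ((cmk_measurable_upper i T c).2.2.prodMk (cmk_measurable_upper i T c).2.1)

/-- The law of (shared sample supported on the shared coordinates, upper noise). [folklore] -/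
def cmkμ2 (i : ℤ) (T : Set ℤ) (c : ℤ) : Measure (SDE.KJ × SDE.KJ) := (SDE.PJ.map (cmkPr i (decide (i ∈ T)) c)).prod SDE.PJ

/-- `cmkμ2` is a probability measure. [folklore] -/
instance cmk_isProbabilityMeasure_μ2 (i : ℤ) (T : Set ℤ) (c : ℤ) : IsProbabilityMeasure (cmkμ2 i T c) := by
  haveI : IsProbabilityMeasure (SDE.PJ.map (cmkPr i (decide (i ∈ T)) c)) :=
    Measure.isProbabilityMeasure_map (cmk_measurable_pr i _ c).aemeasurable
  unfold cmkμ2; infer_instance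

/-- THE UPPER CONDITIONAL DISTRIBUTION of the middle row `0` given (shared coordinates, upper statistic, rows
`(c, 0)`). [folklore] -/
def cmkKer (i : ℤ) (T : Set ℤ) (c : ℤ) : Kernel cmkStatSp (Bool × Bool × Bool) := condDistrib (cmkY i T c) (cmkX i T c) (cmkμ2 i T c)

/-- `cmkKer` is a Markov kernel. [folklore] -/
instance cmk_isMarkovKernel_ker (i : ℤ) (T : Set ℤ) (c : ℤ) : IsMarkovKernel (cmkKer i T c) := by unfold cmkKer; infer_instance

/-- The full conditional distribution of the middle row `0` given the row statistic. [folklore] -/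
def cmkK0 (i : ℤ) (T : Set ℤ) : Kernel ((Obs × Set (Site 2 × Site 2)) × Obs) (Bool × Bool × Bool) :=
  haveI := isProbabilityMeasure_nuMix T
  condDistrib (rowBool i) (rowStat i) (νmix T)

/-- `cmkK0` is a Markov kernel. [folklore] -/
instance cmk_isMarkovKernel_k0 (i : ℤ) (T : Set ℤ) : IsMarkovKernel (cmkK0 i T) := by
  haveI := isProbabilityMeasure_nuMix T
  unfold cmkK0; infer_instance

/-- READING the upper conditioning data off a statistic value, for the cut row `c`. [folklore] -/
def cmkRed (i : ℤ) (T : Set ℤ) (c : ℤ) (t : (Obs × Set (Site 2 × Site 2)) × Obs) : cmkStatSp :=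
  (cmkΓ i (decide (i ∈ T)) c t.1.1, cmkPi2' i c t.1.2, cmkTrunc c t.2)

/-- `cmkRed` is measurable. [folklore] -/
theorem cmk_measurable_red (i : ℤ) (T : Set ℤ) (c : ℤ) : Measurable (cmkRed i T c) :=
  ((cmk_measurable_Γ i c _).comp (measurable_fst.comp measurable_fst)).prodMk
    (((cmk_measurable_pi2' i c).comp (measurable_snd.comp measurable_fst)).prodMk ((cmk_measurable_trunc c).comp measurable_snd))

/-- The kernel as a function of (statistic value, cut level). [folklore] -/
def cmkKf (i : ℤ) (T : Set ℤ) (q : ((Obs × Set (Site 2 × Site 2)) × Obs) × ℤ) (y : Bool × Bool × Bool) : ℝ :=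
  if q.2 = 0 then (cmkK0 i T q.1 {y}).toReal else (cmkKer i T q.2 (cmkRed i T q.2 q.1) {y}).toReal

/-- THE CUT-MARKOV KERNEL. [folklore] -/
def cmkK (i : ℤ) (T : Set ℤ) (t : (Obs × Set (Site 2 × Site 2)) × Obs) (y : Bool × Bool × Bool) : ℝ :=
  cmkKf i T (t, cmkCstar i t.1) y

/-- The kernel is measurable in the statistic value. [folklore] -/
theorem cmk_kernel_measurable (i : ℤ) (T : Set ℤ) (y : Bool × Bool × Bool) : Measurable fun t => cmkK i T t y := by
  have hf : Measurable fun q : ((Obs × Set (Site 2 × Site 2)) × Obs) × ℤ => cmkKf i T q y := by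
    refine measurable_from_prod_countable_left fun c => ?_
    by_cases hc : c = 0
    · simp only [cmkKf, hc, if_true]
      exact ((cmkK0 i T).measurable_coe (measurableSet_singleton y)).ennreal_toReal
    · simp only [cmkKf, hc, if_false]
      exact (((cmkKer i T c).measurable_coe (measurableSet_singleton y)).comp (cmk_measurable_red i T c)).ennreal_toReal
  exact hf.comp (measurable_id.prodMk ((cmk_measurable_cstar i).comp measurable_fst))

/-- The kernel is nonnegative. [folklore] -/
theorem cmk_kernel_nonneg (i : ℤ) (T : Set ℤ) (t : (Obs × Set (Site 2 × Site 2)) × Obs) (y : Bool × Bool × Bool) : 0 ≤ cmkK i T t y := by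
  unfold cmkK cmkKf; split_ifs <;> exact ENNReal.toReal_nonneg

/-- Singleton masses of a probability law on the eight row values sum to one. [folklore] -/
theorem cmk_sum_toReal_singleton (μ : Measure (Bool × Bool × Bool)) [IsProbabilityMeasure μ] : ∑ b, (μ {b}).toReal = 1 := by
  have h := sum_measure_preimage_singleton (μ := μ) Finset.univ (f := id) (fun b _ => measurableSet_singleton b)
  simp only [Finset.coe_univ, preimage_univ, measure_univ, preimage_id_eq, id_eq] at h
  rw [← ENNReal.toReal_sum (fun b _ => measure_ne_top μ _), h, ENNReal.toReal_one]

/-- The kernel is a probability vector. [folklore] -/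
theorem cmk_kernel_sum_one (i : ℤ) (T : Set ℤ) (t : (Obs × Set (Site 2 × Site 2)) × Obs) : ∑ y, cmkK i T t y = 1 := by
  unfold cmkK cmkKf
  split_ifs
  · haveI : IsProbabilityMeasure (cmkK0 i T t) := IsMarkovKernel.isProbabilityMeasure _
    exact cmk_sum_toReal_singleton _
  · haveI : IsProbabilityMeasure (cmkKer i T (cmkCstar i t.1) (cmkRed i T (cmkCstar i t.1) t)) := IsMarkovKernel.isProbabilityMeasure _
    exact cmk_sum_toReal_singleton _

/-- THE KERNEL READS THE PAST ONLY STRICTLY ABOVE A CUT ROW below row `0` (registered sub-goal `cmk_kernel_reads`). [folklore] -/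
theorem cmk_kernel_reads : ∀ (i : ℤ) (T : Set ℤ) (p : Obs × Set (Site 2 × Site 2)) (z z' : Obs) (c : ℤ), c ≤ -1 → IsCut i c p →
    (∀ w : Site 2, c + 1 ≤ w 1 → ((w ∈ z.1 ↔ w ∈ z'.1) ∧ (w ∈ z.2 ↔ w ∈ z'.2))) → cmkK i T (p, z) = cmkK i T (p, z') := by
  intro i T p z z' c hc hcut hz
  obtain ⟨h1, h2, -⟩ := cmk_cstar_of_isCut i hc hcut
  have hne : cmkCstar i p ≠ 0 := by omega
  have ht : cmkTrunc (cmkCstar i p) z = cmkTrunc (cmkCstar i p) z' := by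
    refine Prod.ext (Set.ext fun w => ?_) (Set.ext fun f => ?_) <;> simp only [cmkTrunc, mem_setOf_eq]
    · constructor
      · rintro ⟨hw, hw1⟩; exact ⟨(hz w (by omega)).1.1 hw, hw1⟩
      · rintro ⟨hw, hw1⟩; exact ⟨(hz w (by omega)).1.2 hw, hw1⟩
    · constructor
      · rintro ⟨hf, hf1⟩; exact ⟨(hz f (by omega)).2.1 hf, hf1⟩
      · rintro ⟨hf, hf1⟩; exact ⟨(hz f (by omega)).2.2 hf, hf1⟩
  funext y
  simp only [cmkK, cmkKf, hne, if_false, cmkRed, ht]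

end Summit.CriticalPhenomena.CardyFormulaZ2.Theorems.IKLinearTransport.PinnedDiagramExchange
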